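import Summits.ValiantsHypothesis.ValiantsHypothesis.Theorems.FeketeSOSFeketeSOSHardPaleyRIPFlatRIPConsequences
import Mathlib.Analysis.SpecialFunctions.Pow.Real

/-!
# Route FeketeSOS — crux `FeketeSOSHard` (stmt-ValiantsHypothesis-3996), line `paley-rip`,
# stub `stub_paleyFlatRIP`: the engine bounds the PALEY CLIQUE NUMBER below `√p`

The line's engine `stub_paleyFlatRIP` concerns the Paley–Hankel (SUM) matrix `(χ_p(a+b))`.  Reflecting one
variable, `b ↦ −b (mod p)`, turns flat sums over `A × B` for the sum matrix into flat sums for the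
DIFFERENCE matrix `(χ_p(a−b))` — the ±1 adjacency pattern of the Paley graph (`p ≡ 1 (4)`) / Paley
tournament (`p ≡ 3 (4)`), i.e. `√p`-times the Gram-type matrix of the Paley ETF in Bandeira–Mixon–Moreira
(IMRN 2017, arXiv:1410.6457, §2).  Hence, taking the registered statement of the engine VERBATIM as a
hypothesis:

* `charSum_reflect` — `Σ_{a∈A, b'∈−B} χ_p(a+b') = Σ_{a∈A, b∈B} χ_p(a−b)` for `B ⊆ [0,p)`,
  `−B = {(p−b) mod p}` (same cardinality, inside `[0,p)`);
* `paleyDiffDiscrepancy_of_flatRIP` — the engine implies flat restricted discrepancy of the Paley GRAPH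
  beyond `√p`: `|Σ_{a∈A,b∈B} χ_p(a−b)| ≤ p^{1/2−κ} √(#A·#B)` for all large `p` and all `A, B ⊆ [0,p)` with
  `#A, #B ≤ p^{1/2+δ}` (Chung 1994 Conj. 2.2-type; `PaleyDiscrepancy` in BMM17's notation);
* `paleyClique_card_le_of_flatRIP` — the engine implies `ω(Paley_p) ≤ p^{1/2−κ} + 1` for all large `p`:
  every `C ⊆ [0,p)` with `χ_p(a−b) = 1` for all `a ≠ b ∈ C` has `#C ≤ p^{1/2−κ} + 1`.  This is
  `PaleyClique[τ]` with `τ < 1/2` (BMM17 Thm 2.3's final consequence); unconditionally only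
  `ω ≤ √(p/2) + 1` (Hanson–Petridis 2021) is known, and `ω ≤ p^{1/2−ε}` is a notorious open problem —
  which is therefore a NECESSARY consequence of the line's engine.

Honest framing: consequences of the OPEN engine (hypothesis `hB`), landed `--supports` the crux item to
document the engine's difficulty class; the crux `FeketeSOSHard`, the engine and `stub_tameReduction`
remain open; nothing here bears on `VP ≠ VNP`.
-/

-- the line's namespace repeats a path segment by convention (same as the other paley-rip files)
set_option linter.dupNamespace false

namespace Summit.ValiantsHypothesis.ValiantsHypothesis.Theorems.FeketeSOSHardPaleyRIP

open Finset
open scoped BigOperators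

noncomputable section

section Reflection

variable (p : ℕ) [Fact p.Prime]

/-- Reflection `b ↦ (p − b) mod p` turns `χ_p(a + ·)` into `χ_p(a − ·)`. [folklore] -/
theorem legendreSym_add_reflect (a b : ℕ) (hb : b < p) :
    legendreSym p ((a : ℤ) + (((p - b) % p : ℕ) : ℤ)) = legendreSym p ((a : ℤ) - b) := by
  unfold legendreSym
  congr 1
  simp only [Int.cast_add, Int.cast_natCast, Int.cast_sub, ZMod.natCast_mod]
  rw [Nat.cast_sub hb.le, ZMod.natCast_self]
  ring

omit [Fact p.Prime] in
/-- The reflection is injective on `[0,p)`. [folklore] -/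
theorem reflect_injOn (B : Finset ℕ) (hB : ∀ b ∈ B, b < p) :
    Set.InjOn (fun b : ℕ => (p - b) % p) (B : Set ℕ) := by
  intro b hb b' hb' h
  have hbp := hB b hb
  have hbp' := hB b' hb'
  have h' : (p - b) % p = (p - b') % p := h
  have key : ∀ c : ℕ, c < p → (p - ((p - c) % p)) % p = c := by
    intro c hc
    rcases Nat.eq_zero_or_pos c with h0 | hpos
    · subst h0
      rw [Nat.sub_zero, Nat.mod_self, Nat.sub_zero, Nat.mod_self]
    · rw [Nat.mod_eq_of_lt (by omega : p - c < p)]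
      rw [Nat.mod_eq_of_lt (by omega : p - (p - c) < p)]
      omega
  have h2 : (p - ((p - b) % p)) % p = (p - ((p - b') % p)) % p := by rw [h']
  rwa [key b hbp, key b' hbp'] at h2

/-- The reflected set lies in `[0,p)`. [folklore] -/
theorem reflect_lt (B : Finset ℕ) : ∀ b' ∈ B.image (fun b : ℕ => (p - b) % p), b' < p := by
  intro b' hb'
  obtain ⟨b, _, rfl⟩ := mem_image.1 hb'
  exact Nat.mod_lt _ (Fact.out : p.Prime).pos

omit [Fact p.Prime] in
/-- The reflected set has the same cardinality. [folklore] -/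
theorem card_reflect (B : Finset ℕ) (hB : ∀ b ∈ B, b < p) :
    (B.image (fun b : ℕ => (p - b) % p)).card = B.card :=
  card_image_of_injOn (reflect_injOn p B hB)

/-- **Reflection identity.** `Σ_{a∈A} Σ_{b'∈−B} χ_p(a+b') = Σ_{a∈A} Σ_{b∈B} χ_p(a−b)` for `B ⊆ [0,p)`.
[folklore] -/
theorem charSum_reflect (A B : Finset ℕ) (hB : ∀ b ∈ B, b < p) :
    ∑ a ∈ A, ∑ b' ∈ B.image (fun b : ℕ => (p - b) % p), ((legendreSym p ((a : ℤ) + b') : ℤ) : ℂ) =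
      ∑ a ∈ A, ∑ b ∈ B, ((legendreSym p ((a : ℤ) - b) : ℤ) : ℂ) := by
  refine sum_congr rfl fun a _ => ?_
  rw [sum_image (reflect_injOn p B hB)]
  refine sum_congr rfl fun b hb => ?_
  rw [legendreSym_add_reflect p a b (hB b hb)]

end Reflection

section Consequences

/-- **The engine implies flat restricted discrepancy of the Paley graph (difference matrix) beyond
`√p`.**  From `stub_paleyFlatRIP` (hypothesis, verbatim): `∃ κ, δ > 0 ∀` large `p ∀ A, B ⊆ [0,p)` with
`#A, #B ≤ p^{1/2+δ}`: `|Σ_{a∈A,b∈B} χ_p(a−b)| ≤ p^{1/2−κ} √(#A·#B)`.  Proof: sum discrepancy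
(`paleySumDiscrepancy_of_flatRIP`) applied to `A` and `−B`. [folklore] -/
theorem paleyDiffDiscrepancy_of_flatRIP
    (hB : ∃ κ : ℝ, 0 < κ ∧ ∃ δ₁ : ℝ, 0 < δ₁ ∧ ∃ p₁ : ℕ, ∀ (p : ℕ) [Fact p.Prime], p₁ ≤ p →
      ∀ (S : Finset ℕ), (∀ a ∈ S, a < p) → (S.card : ℝ) ≤ (p : ℝ) ^ (1 / 2 + δ₁) →
      ∀ (w : ℕ → ℂ), ‖paleyForm p S w‖ ≤ (p : ℝ) ^ (1 / 2 - κ) * ∑ a ∈ S, ‖w a‖ ^ 2) :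
    ∃ κ : ℝ, 0 < κ ∧ ∃ δ : ℝ, 0 < δ ∧ ∃ p₁ : ℕ, ∀ (p : ℕ) [Fact p.Prime], p₁ ≤ p →
      ∀ (A B : Finset ℕ), (∀ a ∈ A, a < p) → (∀ b ∈ B, b < p) →
        (A.card : ℝ) ≤ (p : ℝ) ^ (1 / 2 + δ) → (B.card : ℝ) ≤ (p : ℝ) ^ (1 / 2 + δ) →
        ‖∑ a ∈ A, ∑ b ∈ B, ((legendreSym p ((a : ℤ) - b) : ℤ) : ℂ)‖ ≤
          (p : ℝ) ^ (1 / 2 - κ) * Real.sqrt ((A.card : ℝ) * B.card) := by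
  classical
  obtain ⟨κ, hκ, δ, hδ, p₁, hD⟩ := paleySumDiscrepancy_of_flatRIP hB
  refine ⟨κ, hκ, δ, hδ, p₁, ?_⟩
  intro p _ hp A B hA hBp hAc hBc
  have h := hD p hp A (B.image (fun b : ℕ => (p - b) % p)) hA (reflect_lt p B)
    hAc (by rw [card_reflect p B hBp]; exact hBc)
  rwa [charSum_reflect p A B hBp, card_reflect p B hBp] at h

/-- The difference character sum over a Paley clique `C` (`χ_p(a−b) = 1` for `a ≠ b ∈ C`) is exactly
`#C² − #C` (diagonal terms `χ_p(0) = 0`). [folklore] -/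
theorem paleyClique_charSum_eq (p : ℕ) [Fact p.Prime] (C : Finset ℕ)
    (hC : ∀ a ∈ C, ∀ b ∈ C, a ≠ b → legendreSym p ((a : ℤ) - b) = 1) :
    ∑ a ∈ C, ∑ b ∈ C, legendreSym p ((a : ℤ) - b) = (C.card : ℤ) ^ 2 - C.card := by
  classical
  have hrow : ∀ a ∈ C, ∑ b ∈ C, legendreSym p ((a : ℤ) - b) = (C.card : ℤ) - 1 := by
    intro a ha
    rw [← add_sum_erase C (fun b => legendreSym p ((a : ℤ) - b)) ha]
    have hoff : ∑ b ∈ C.erase a, legendreSym p ((a : ℤ) - b) = ((C.erase a).card : ℤ) := by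
      rw [sum_congr rfl (fun b hb => hC a ha b (mem_of_mem_erase hb) (ne_of_mem_erase hb).symm)]
      simp
    rw [hoff, card_erase_of_mem ha, sub_self, legendreSym.at_zero]
    have hc : 1 ≤ C.card := card_pos.2 ⟨a, ha⟩
    push_cast [Nat.cast_sub hc]
    ring
  rw [sum_congr rfl hrow, sum_const, nsmul_eq_mul]
  ring

/-- **The engine bounds the Paley clique number below `√p`** (`PaleyClique[τ]`, `τ < 1/2`, the last link of
Bandeira–Mixon–Moreira 2017, Thm 2.3, in the line's setting).  From `stub_paleyFlatRIP` (hypothesis,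
verbatim): `∃ κ > 0 ∃ p₁ ∀ p ≥ p₁` prime, every `C ⊆ [0,p)` with `χ_p(a−b) = 1` for all `a ≠ b ∈ C` has
`#C ≤ p^{1/2−κ} + 1`.  (Unconditionally only `√(p/2) + 1`, Hanson–Petridis, is known.)  Proof: difference
discrepancy with `A = B = C` (or a `⌊p^{1/2+δ}⌋`-sub-clique): `#C² − #C ≤ p^{1/2−κ} #C`. [folklore] -/
theorem paleyClique_card_le_of_flatRIP
    (hB : ∃ κ : ℝ, 0 < κ ∧ ∃ δ₁ : ℝ, 0 < δ₁ ∧ ∃ p₁ : ℕ, ∀ (p : ℕ) [Fact p.Prime], p₁ ≤ p →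
      ∀ (S : Finset ℕ), (∀ a ∈ S, a < p) → (S.card : ℝ) ≤ (p : ℝ) ^ (1 / 2 + δ₁) →
      ∀ (w : ℕ → ℂ), ‖paleyForm p S w‖ ≤ (p : ℝ) ^ (1 / 2 - κ) * ∑ a ∈ S, ‖w a‖ ^ 2) :
    ∃ κ : ℝ, 0 < κ ∧ ∃ p₁ : ℕ, ∀ (p : ℕ) [Fact p.Prime], p₁ ≤ p →
      ∀ (C : Finset ℕ), (∀ a ∈ C, a < p) →
        (∀ a ∈ C, ∀ b ∈ C, a ≠ b → legendreSym p ((a : ℤ) - b) = 1) →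
        (C.card : ℝ) ≤ (p : ℝ) ^ (1 / 2 - κ) + 1 := by
  classical
  obtain ⟨κ₀, hκ₀, δ, hδ, p₁, hD⟩ := paleyDiffDiscrepancy_of_flatRIP hB
  set κ : ℝ := min κ₀ (1 / 2) with hκdef
  have hκ : 0 < κ := lt_min hκ₀ (by norm_num)
  have hκle : κ ≤ κ₀ := min_le_left _ _
  have hκhalf : κ ≤ 1 / 2 := min_le_right _ _
  obtain ⟨N, hN⟩ : ∃ N : ℕ, (4 : ℝ) ^ (1 / (δ + κ)) ≤ (N : ℝ) := ⟨_, Nat.le_ceil _⟩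
  refine ⟨κ, hκ, max p₁ N, ?_⟩
  intro p _ hp C hCp hC
  have hprime : p.Prime := Fact.out
  have hp0 : (0 : ℝ) < (p : ℝ) := by exact_mod_cast hprime.pos
  have hp1 : (1 : ℝ) ≤ (p : ℝ) := by exact_mod_cast hprime.one_lt.le
  have hp₁ : p₁ ≤ p := le_trans (le_max_left _ _) hp
  have hpN : (N : ℝ) ≤ (p : ℝ) := by exact_mod_cast le_trans (le_max_right _ _) hp
  have h4 : (4 : ℝ) ≤ (p : ℝ) ^ (δ + κ) := by
    have h0 : (0 : ℝ) ≤ (4 : ℝ) ^ (1 / (δ + κ)) := Real.rpow_nonneg (by norm_num) _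
    calc (4 : ℝ) = ((4 : ℝ) ^ (1 / (δ + κ))) ^ (δ + κ) := by
          rw [one_div, Real.rpow_inv_rpow (by norm_num) (by positivity)]
      _ ≤ (p : ℝ) ^ (δ + κ) := Real.rpow_le_rpow h0 (hN.trans hpN) (by positivity)
  have hθ1 : (1 : ℝ) ≤ (p : ℝ) ^ (1 / 2 - κ) := Real.one_le_rpow hp1 (by linarith)
  have hθmono : (p : ℝ) ^ (1 / 2 - κ₀) ≤ (p : ℝ) ^ (1 / 2 - κ) :=
    Real.rpow_le_rpow_of_exponent_le hp1 (by linarith)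
  -- Step A: small cliques
  have stepA : ∀ C' : Finset ℕ, (∀ a ∈ C', a < p) →
      (∀ a ∈ C', ∀ b ∈ C', a ≠ b → legendreSym p ((a : ℤ) - b) = 1) →
      (C'.card : ℝ) ≤ (p : ℝ) ^ (1 / 2 + δ) → (C'.card : ℝ) ≤ (p : ℝ) ^ (1 / 2 - κ) + 1 := by
    intro C' hC'p hC' hC'c
    have hw := hD p hp₁ C' C' hC'p hC'p hC'c hC'c
    have hform : ∑ a ∈ C', ∑ b ∈ C', ((legendreSym p ((a : ℤ) - b) : ℤ) : ℂ) =
        (((C'.card : ℤ) ^ 2 - C'.card : ℤ) : ℂ) := by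
      rw [← paleyClique_charSum_eq p C' hC']
      push_cast
      rfl
    have hsq : Real.sqrt ((C'.card : ℝ) * C'.card) = C'.card := Real.sqrt_mul_self (Nat.cast_nonneg _)
    rw [hform, hsq, Complex.norm_intCast] at hw
    have hlowR : (C'.card : ℝ) ^ 2 - C'.card ≤ |(((C'.card : ℤ) ^ 2 - C'.card : ℤ) : ℝ)| := by
      refine le_trans (le_of_eq ?_) (le_abs_self _)
      push_cast
      ring
    have hmain : (C'.card : ℝ) ^ 2 - C'.card ≤ (p : ℝ) ^ (1 / 2 - κ) * C'.card :=
      hlowR.trans (hw.trans (mul_le_mul_of_nonneg_right hθmono (Nat.cast_nonneg _)))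
    rcases Nat.eq_zero_or_pos C'.card with h0 | hpos
    · rw [h0]; push_cast; linarith
    · have hc : (0 : ℝ) < C'.card := by exact_mod_cast hpos
      have : (C'.card : ℝ) - 1 ≤ (p : ℝ) ^ (1 / 2 - κ) := by
        by_contra hlt
        push Not at hlt
        nlinarith
      linarith
  -- Step B: a large clique contains a `⌊p^{1/2+δ}⌋`-sub-clique, contradicting Step A
  by_cases hsmall : (C.card : ℝ) ≤ (p : ℝ) ^ (1 / 2 + δ)
  · exact stepA C hCp hC hsmall
  · exfalso
    push Not at hsmall
    set n : ℕ := ⌊(p : ℝ) ^ (1 / 2 + δ)⌋₊ with hndef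
    have hKnn : 0 ≤ (p : ℝ) ^ (1 / 2 + δ) := Real.rpow_nonneg hp0.le _
    have hnle : (n : ℝ) ≤ (p : ℝ) ^ (1 / 2 + δ) := Nat.floor_le hKnn
    have hnlt : (p : ℝ) ^ (1 / 2 + δ) < (n : ℝ) + 1 := Nat.lt_floor_add_one _
    have hnC : n ≤ C.card := by exact_mod_cast (hnle.trans hsmall.le)
    obtain ⟨C', hC'sub, hC'card⟩ := exists_subset_card_eq hnC
    have hA := stepA C' (fun a ha => hCp a (hC'sub ha))
      (fun a ha b hb hab => hC a (hC'sub ha) b (hC'sub hb) hab) (by rw [hC'card]; exact hnle)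
    rw [hC'card] at hA
    have hsplit : (p : ℝ) ^ (1 / 2 + δ) = (p : ℝ) ^ (1 / 2 - κ) * (p : ℝ) ^ (δ + κ) := by
      rw [← Real.rpow_add hp0]; ring_nf
    have hbig : (p : ℝ) ^ (1 / 2 - κ) + 3 ≤ (p : ℝ) ^ (1 / 2 + δ) := by
      rw [hsplit]; nlinarith
    linarith

end Consequences

end

end Summit.ValiantsHypothesis.ValiantsHypothesis.Theorems.FeketeSOSHardPaleyRIP
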